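import Mathlib
import Summits.CriticalPhenomena.CardyFormulaZ2.Theorems.CardyMagicRigidityDefs
import Literature.Geometry.DiscreteGeometry.CountingSpheresDisks
import HarnessLib

/-!
# Sanity checks for stub S2 `TowerPressureFamily` (line `ring-cloud-tomography`, crux `NestingRigidity`)

Crux `Summit.CriticalPhenomena.CardyFormulaZ2.Theses.CardyMagicRigidity.NestingRigidity`
(stmt-CriticalPhenomena-4835), line `ring-cloud-tomography`, stub `stub_towerPressureFamily : TowerPressureFamily`
(`∀ E ∈ latticeEnsembles, E.CloudLaw → ∃ a, E.HasTowerPressure (pressureFamily a) (Icc 0 √3)`).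

This file verifies the constants of the statement and lands its `u = 1` slice on both lattices:

* §1 the special values of the pressure family and of Schramm–Sheffield–Wilson's exponent
  (`arccos (1/2) = π/3`, `arccos (√3/2) = π/6` are `Literature.Geometry.DiscreteGeometry.arccos_one_half`,
  `…arccos_sqrt_three_div_two`; `arccos 0 = π/2` is Mathlib's `Real.arccos_zero`):
  `pressureFamily a 1 = 0`, `e6 1 = 0`, `e6 0 = 5/48` (one-arm), `e6 √3 = -1/16`, and the identity
  `e6 = pressureFamily (1/(2π))` (the value singled out by `ChargeQuantisation`);
* §2 `towerMoment_one`: the weight-`1` tower moment of any ensemble with a probability law is `1`, whence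
  the registered sub-goal `hasTowerPressure_singleton_one`: every `e` with `e 1 = 0` is a tower pressure on
  the singleton weight set `{1}` for both lattice ensembles (`ρ ^ ε ≤ 1 ≤ ρ ^ (-ε)` for `ρ ∈ (0,1)`).
-/

noncomputable section

open MeasureTheory Set Filter Metric
open scoped Real Topology BigOperators

namespace Summit.CriticalPhenomena.CardyFormulaZ2.Cruxes.NestingRigidity.RingCloudTomography

open Literature.Probability.RandomPlanarGeometry Literature.Probability.Percolation
  Literature.Probability.LatticeModels

/-! ## §1 Special values of `pressureFamily` and `e6` -/

/-- Every member of the pressure family vanishes at the trivial weight `u = 1`. -/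
theorem pressureFamily_one (a : ℝ) : pressureFamily a 1 = 0 := by
  unfold pressureFamily
  rw [Literature.Geometry.DiscreteGeometry.arccos_one_half]
  ring

/-- `e₆(1) = 0` (trivial weight). -/
theorem e6_one : e6 1 = 0 := by
  unfold e6
  rw [Literature.Geometry.DiscreteGeometry.arccos_one_half]
  field_simp
  ring

/-- `e₆(0) = 5/48` (the one-arm exponent). -/
theorem e6_zero : e6 0 = 5 / 48 := by
  unfold e6
  rw [zero_div, Real.arccos_zero]
  field_simp
  ring

/-- `e₆(√3) = -1/16`. -/
theorem e6_sqrt_three : e6 (Real.sqrt 3) = -1 / 16 := by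
  unfold e6
  rw [Literature.Geometry.DiscreteGeometry.arccos_sqrt_three_div_two]
  field_simp
  ring

/-- Schramm–Sheffield–Wilson's exponent is the member `a = 1/(2π)` of the pressure family. -/
theorem e6_eq_pressureFamily : e6 = pressureFamily (1 / (2 * π)) := by
  funext u
  unfold e6 pressureFamily
  field_simp
  ring

/-! ## §2 The `u = 1` slice -/

/-- Both lattice ensembles carry probability laws. -/
theorem isProbabilityMeasure_of_mem {E : LoopEnsemble} (hE : E ∈ latticeEnsembles) :
    IsProbabilityMeasure E.P := by
  simp only [latticeEnsembles, Set.mem_insert_iff, Set.mem_singleton_iff] at hE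
  rcases hE with rfl | rfl
  · exact instIsProbabilityMeasureBondPercolation (zdGraph 2) half
  · exact instIsProbabilityMeasureTriSitePercolation half

/-- The weight-`1` tower moment of an ensemble with a probability law is `1`. -/
theorem towerMoment_one (E : LoopEnsemble) [IsProbabilityMeasure E.P] (δ ρ : ℝ) :
    E.towerMoment 1 δ ρ = 1 := by
  simp [LoopEnsemble.towerMoment]

/-- The `u = 1` slice of `TowerPressureFamily` on both lattices: any exponent function vanishing at `1`
is a tower pressure on the singleton weight set `{1}` (`ρ ^ ε ≤ 1 ≤ ρ ^ (-ε)` for `ρ ∈ (0, 1)`). -/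
theorem hasTowerPressure_singleton_one :
    ∀ E ∈ latticeEnsembles, ∀ e : ℝ → ℝ, e 1 = 0 → E.HasTowerPressure e {1} := by
  intro E hE e he1 u hu ε hε
  haveI := isProbabilityMeasure_of_mem hE
  rw [Set.mem_singleton_iff] at hu
  subst hu
  rw [he1, zero_add, zero_sub]
  filter_upwards [Ioo_mem_nhdsGT (zero_lt_one' ℝ)] with ρ hρ
  refine Filter.Eventually.of_forall fun δ ↦ ?_
  rw [towerMoment_one]
  exact ⟨Real.rpow_le_one hρ.1.le hρ.2.le hε.le,
    Real.one_le_rpow_of_pos_of_le_one_of_nonpos hρ.1 hρ.2.le (neg_nonpos.mpr hε.le)⟩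

end Summit.CriticalPhenomena.CardyFormulaZ2.Cruxes.NestingRigidity.RingCloudTomography

end
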